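import Literature.Analysis.FluidPDE.EnstrophyGronwall
import Literature.Analysis.FluidPDE.NSCriticalClosureTao
import Literature.Analysis.FluidPDE.NSVorticityBKMContinuation
import Literature.Analysis.FluidPDE.ConstantinDirectionDissipationCalculus
import Literature.Analysis.FluidPDE.TaoLocalisation
import Summits.NavierStokesRegularity.NavierStokesRegularity.Theorems.TypeICertificateLadderRungReynoldsOneWeightedSlab

/-!
# Rung `X_1` (crux `RungReynoldsOne`, stmt-2882), line `lp-vorticity-young-budget`: a-priori power rates

Along a classical Leray–Hopf Schwartz-datum solution `u` on `ℝ³ × [0,T)` with eventual rate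
`√(T−t)‖u(t,x)‖ ≤ √ν`, the weighted `L^{5/2}`-vorticity slab inequality (stub S3; weight
`F(y) = (|y|²+1)^{5/4} − 1`) and the sharp `q = 2` enstrophy slab inequality
(`Target.Negative.lintegral_frobeniusNormSq_le_exp_half_linfty`), applied on the Tao-class closed
sub-slabs `[0,t]` (stub S5), give `∫F(curl u(t)) ≤ K₁(T−t)^{-15/16}`, `∫|∇u(t)|² ≤ K₂(T−t)^{-1/2}`
and `‖u(t,x)‖² ≤ M/(T−t)` on `(0,T)`: with `B₀` bounding `u` on `[0,t₀]` (before the rate sets in),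
`‖u(s)‖²_∞ ≤ B₀² + ν/(T−s)`, so `∫₀ᵗ‖u‖²_∞ ≤ B₀²T + ν log(T/(T−t))` and
`exp(κ∫₀ᵗ‖u‖²_∞) ≤ e^{κB₀²T}(T/(T−t))^{κν}`, `κν = 15/16` resp. `1/2`. [folklore: Grönwall bookkeeping]
-/

noncomputable section

open Set Filter Topology MeasureTheory
open scoped RealInnerProductSpace ENNReal NNReal Laplacian ContDiff
open Literature.Analysis.FluidPDE

namespace Summit.NavierStokesRegularity.NavierStokesRegularity.Theorems.RungReynoldsOne

-- the problem directory `NavierStokesRegularity/NavierStokesRegularity` forces the duplicated namespace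
set_option linter.dupNamespace false

/-- `∫₀ᵗ ν/(T−s) ds = ν log(T/(T−t))` for `0 ≤ t < T`, as a lower Lebesgue integral. -/
theorem lintegral_Ioo_div_sub_eq {ν T t : ℝ} (hν : 0 ≤ ν) (ht0 : 0 ≤ t) (htT : t < T) :
    ∫⁻ s in Ioo 0 t, ENNReal.ofReal (ν / (T - s)) = ENNReal.ofReal (ν * Real.log (T / (T - t))) := by
  have hT : 0 < T := lt_of_le_of_lt ht0 htT
  have hpos : ∀ s ∈ Icc 0 t, 0 < T - s := fun s hs => by linarith [hs.2]
  have hcont : ContinuousOn (fun s => ν / (T - s)) (Icc 0 t) :=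
    continuousOn_const.div (continuousOn_const.sub continuousOn_id) fun s hs => (hpos s hs).ne'
  have hint : IntegrableOn (fun s => ν / (T - s)) (Ioo 0 t) volume :=
    (hcont.integrableOn_compact isCompact_Icc).mono_set Ioo_subset_Icc_self
  have hnn : 0 ≤ᵐ[volume.restrict (Ioo 0 t)] fun s => ν / (T - s) := by
    refine (ae_restrict_iff' measurableSet_Ioo).2 (Eventually.of_forall fun s hs => ?_)
    exact div_nonneg hν (hpos s (Ioo_subset_Icc_self hs)).le
  rw [← ofReal_integral_eq_lintegral_ofReal hint hnn]
  congr 1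
  -- FTC with the antiderivative `s ↦ -ν log (T - s)`
  have hderiv : ∀ s ∈ uIcc 0 t, HasDerivAt (fun s => -ν * Real.log (T - s)) (ν / (T - s)) s := by
    intro s hs
    rw [uIcc_of_le ht0] at hs
    have h1 : HasDerivAt (fun s => T - s) (-1) s := by simpa using (hasDerivAt_id s).const_sub T
    have h2 := (h1.log (hpos s hs).ne').const_mul (-ν)
    refine h2.congr_deriv ?_
    have hne : T - s ≠ 0 := (hpos s hs).ne'
    field_simp
  have hFTC := intervalIntegral.integral_eq_sub_of_hasDerivAt hderiv
    ((hcont.mono (by rw [uIcc_of_le ht0])).intervalIntegrable)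
  rw [← integral_Ioc_eq_integral_Ioo, ← intervalIntegral.integral_of_le ht0, hFTC]
  have hTt : 0 < T - t := hpos t ⟨ht0, le_rfl⟩
  rw [sub_zero, Real.log_div hT.ne' hTt.ne']
  ring

/-- `exp(κ(a + ν log r)) = exp(κa) · r^{κν}` for `r > 0`. -/
theorem exp_mul_add_mul_log {κ a ν r : ℝ} (hr : 0 < r) :
    Real.exp (κ * (a + ν * Real.log r)) = Real.exp (κ * a) * r ^ (κ * ν) := by
  rw [mul_add, Real.exp_add, Real.rpow_def_of_pos hr]; congr 2; ring

/-- A pointwise bound gives the `L^∞` bound: `‖f‖_∞ ≤ b` (in `ℝ`, via `toReal`). -/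
theorem toReal_eLpNorm_top_le_of_bound {f : EuclideanSpace ℝ (Fin 3) → EuclideanSpace ℝ (Fin 3)}
    {b : ℝ} (hb : 0 ≤ b) (hf : ∀ x, ‖f x‖ ≤ b) : (eLpNorm f ⊤ volume).toReal ≤ b := by
  refine ENNReal.toReal_le_of_le_ofReal hb ?_
  rw [eLpNorm_exponent_top]
  exact eLpNormEssSup_le_of_ae_bound (Eventually.of_forall hf)

/-- The rung-one rate squared: `√(T−t)‖y‖ ≤ √ν` with `t < T` gives `‖y‖² ≤ ν/(T−t)`. -/
theorem sq_norm_le_of_rate {ν T t : ℝ} (hν : 0 ≤ ν) (htT : t < T) {y : EuclideanSpace ℝ (Fin 3)}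
    (h : Real.sqrt (T - t) * ‖y‖ ≤ Real.sqrt ν) : ‖y‖ ^ 2 ≤ ν / (T - t) := by
  have hTt : 0 < T - t := sub_pos.2 htT; have h0 : 0 ≤ Real.sqrt (T - t) * ‖y‖ := by positivity
  have h2 : (Real.sqrt (T - t) * ‖y‖) ^ 2 ≤ (Real.sqrt ν) ^ 2 := pow_le_pow_left₀ h0 h 2
  rw [mul_pow, Real.sq_sqrt hTt.le, Real.sq_sqrt hν] at h2
  rw [le_div_iff₀ hTt]; linarith

/-- `‖curl v x‖ₑ² ≤ 6 ‖D v x‖ₑ²` (from `|curl v|² ≤ 2|∇v|²_F ≤ 6‖Dv‖²`). -/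
theorem enorm_curl_sq_le_six_mul (v : EuclideanSpace ℝ (Fin 3) → EuclideanSpace ℝ (Fin 3))
    (x : EuclideanSpace ℝ (Fin 3)) :
    ‖curl v x‖ₑ ^ 2 ≤ 6 * ‖iteratedFDeriv ℝ 1 v x‖ₑ ^ 2 := by
  have h1 : ‖curl v x‖ₑ ^ 2 ≤ ENNReal.ofReal (2 * frobeniusNormSq (fderiv ℝ v x)) := by
    rw [← ofReal_norm, ← ENNReal.ofReal_pow (norm_nonneg _)]
    exact ENNReal.ofReal_le_ofReal (norm_curl_sq_le_two_mul_frobeniusNormSq v x)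
  refine h1.trans ?_
  rw [ENNReal.ofReal_mul (by norm_num), ← ofReal_norm, norm_iteratedFDeriv_one, ofReal_norm,
    ENNReal.ofReal_ofNat]
  calc (2 : ℝ≥0∞) * ENNReal.ofReal (frobeniusNormSq (fderiv ℝ v x))
      ≤ 2 * (3 * ‖fderiv ℝ v x‖ₑ ^ 2) := by
        gcongr; exact ofReal_frobeniusNormSq_le_three_mul_enorm_sq _
    _ = 6 * ‖fderiv ℝ v x‖ₑ ^ 2 := by ring

/-- **A-priori power rates under collapse Reynolds number one.** GIVEN (i) the sharp `q = 2`
enstrophy slab inequality with time-dependent sup norm (tree: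
`Target.Negative.lintegral_frobeniusNormSq_le_exp_half_linfty`), (ii) the weighted
`L^{5/2}`-vorticity slab inequality (stub S3 of the line) and (iii) the Tao-class cover of closed
sub-slabs (stub S5), every classical solution on `ℝ³ × [0,T)`, Leray–Hopf from its rapidly decaying
datum, with eventual rate `√(T−t)‖u(t,x)‖ ≤ √ν`, satisfies for some constants `K₁, K₂, M` and all
`t ∈ (0,T)`: `∫F(curl u(t)) ≤ K₁(T−t)^{-15/16}`, `∫|∇u(t)|² ≤ K₂(T−t)^{-1/2}`, and
`‖u(t,x)‖² ≤ M/(T−t)` for all `x`. -/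
theorem aprioriDecay_of
    (hSharp : ∀ ⦃ν T : ℝ⦄, 0 < ν → 0 < T →
      ∀ ⦃u : ℝ → EuclideanSpace ℝ (Fin 3) → EuclideanSpace ℝ (Fin 3)⦄
        ⦃p : ℝ → EuclideanSpace ℝ (Fin 3) → ℝ⦄,
        IsClassicalNSSolutionOn (Icc 0 T) ν 0 u p →
        HasBoundedSobolevNormsOn (Icc 0 T) u →
        HasBoundedSobolevNormsOn (Icc 0 T) (timeDerivWithin (Icc 0 T) u) →
        (∀ n : ℕ, ∃ C : ℝ≥0, ∀ t ∈ Icc 0 T, ∫⁻ x, ‖iteratedFDeriv ℝ n (p t) x‖ₑ ^ 2 ≤ C) →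
      ∀ ⦃s : ℝ⦄, s ∈ Ioc 0 T →
        (∫⁻ t in Ioo 0 s, ENNReal.ofReal ((eLpNorm (u t) ⊤ volume).toReal ^ (2 : ℝ)) ≠ ⊤) →
        ∫⁻ x, ENNReal.ofReal (frobeniusNormSq (fderiv ℝ (u s) x)) ≤
          ENNReal.ofReal (Real.exp ((2 * ν)⁻¹ *
              (∫⁻ t in Ioo 0 s, ENNReal.ofReal ((eLpNorm (u t) ⊤ volume).toReal ^ (2 : ℝ))).toReal)) *
            ∫⁻ x, ENNReal.ofReal (frobeniusNormSq (fderiv ℝ (u 0) x)))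
    (hA : ∀ ⦃ν T : ℝ⦄, 0 < ν → 0 < T →
      ∀ ⦃u : ℝ → EuclideanSpace ℝ (Fin 3) → EuclideanSpace ℝ (Fin 3)⦄
        ⦃p : ℝ → EuclideanSpace ℝ (Fin 3) → ℝ⦄,
        IsClassicalNSSolutionOn (Icc 0 T) ν 0 u p →
        HasBoundedSobolevNormsOn (Icc 0 T) u →
        HasBoundedSobolevNormsOn (Icc 0 T) (timeDerivWithin (Icc 0 T) u) →
        (∀ n : ℕ, ∃ C : ℝ≥0, ∀ t ∈ Icc 0 T, ∫⁻ x, ‖iteratedFDeriv ℝ n (p t) x‖ₑ ^ 2 ≤ C) →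
      ∀ ⦃s : ℝ⦄, s ∈ Ioc 0 T →
        (∫⁻ t in Ioo 0 s, ENNReal.ofReal ((eLpNorm (u t) ⊤ volume).toReal ^ (2 : ℝ)) ≠ ⊤) →
        ∫⁻ x, ENNReal.ofReal ((‖curl (u s) x‖ ^ 2 + 1) ^ (5 / 4 : ℝ) - 1) ≤
          ENNReal.ofReal (Real.exp (15 / (16 * ν) *
              (∫⁻ t in Ioo 0 s, ENNReal.ofReal ((eLpNorm (u t) ⊤ volume).toReal ^ (2 : ℝ))).toReal)) *
            ∫⁻ x, ENNReal.ofReal ((‖curl (u 0) x‖ ^ 2 + 1) ^ (5 / 4 : ℝ) - 1))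
    (hC : ∀ ⦃ν T : ℝ⦄, 0 < ν → 0 < T →
      ∀ ⦃u : ℝ → EuclideanSpace ℝ (Fin 3) → EuclideanSpace ℝ (Fin 3)⦄
        ⦃p : ℝ → EuclideanSpace ℝ (Fin 3) → ℝ⦄,
        IsClassicalNSSolutionOn (Ico 0 T) ν 0 u p → IsLerayHopfOn T ν 0 (u 0) u →
        HasRapidSpatialDecay (u 0) →
      ∀ ⦃T' : ℝ⦄, T' ∈ Ioo 0 T →
        ∃ q : ℝ → EuclideanSpace ℝ (Fin 3) → ℝ,
          IsClassicalNSSolutionOn (Icc 0 T') ν 0 u q ∧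
          HasBoundedSobolevNormsOn (Icc 0 T') u ∧
          HasBoundedSobolevNormsOn (Icc 0 T') (timeDerivWithin (Icc 0 T') u) ∧
          (∀ n : ℕ, ∃ C : ℝ≥0, ∀ t ∈ Icc 0 T', ∫⁻ x, ‖iteratedFDeriv ℝ n (q t) x‖ₑ ^ 2 ≤ C))
    {ν T : ℝ} (hν : 0 < ν) (hT : 0 < T)
    {u : ℝ → EuclideanSpace ℝ (Fin 3) → EuclideanSpace ℝ (Fin 3)}
    {p : ℝ → EuclideanSpace ℝ (Fin 3) → ℝ}
    (hsol : IsClassicalNSSolutionOn (Ico 0 T) ν 0 u p) (hLH : IsLerayHopfOn T ν 0 (u 0) u)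
    (hdec : HasRapidSpatialDecay (u 0))
    (hrate : ∀ᶠ t in 𝓝[<] T, ∀ x, Real.sqrt (T - t) * ‖u t x‖ ≤ Real.sqrt ν) :
    ∃ K₁ K₂ M : ℝ, ∀ t ∈ Ioo 0 T,
      (∫⁻ x, ENNReal.ofReal ((‖curl (u t) x‖ ^ 2 + 1) ^ (5 / 4 : ℝ) - 1) ≤
        ENNReal.ofReal (K₁ * (T - t) ^ (-(15 / 16 : ℝ)))) ∧
      (∫⁻ x, ENNReal.ofReal (frobeniusNormSq (fderiv ℝ (u t) x)) ≤
        ENNReal.ofReal (K₂ * (T - t) ^ (-(1 / 2 : ℝ)))) ∧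
      (∀ x, ‖u t x‖ ^ 2 ≤ M / (T - t)) := by
  -- the onset `t₀ ∈ (0, T)` of the rate
  obtain ⟨a, haT, hsub⟩ := mem_nhdsLT_iff_exists_Ioo_subset.1 hrate
  set t₀ : ℝ := (max a (T / 2) + T) / 2 with ht₀def
  have hmax : max a (T / 2) < T := max_lt haT (by linarith)
  have hat₀ : a < t₀ := by
    have := le_max_left a (T / 2); rw [ht₀def]; linarith
  have ht₀ : t₀ ∈ Ioo 0 T := by
    have := le_max_right a (T / 2); rw [ht₀def]; constructor <;> linarith
  have hrate' : ∀ s ∈ Ico t₀ T, ∀ x, Real.sqrt (T - s) * ‖u s x‖ ≤ Real.sqrt ν :=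
    fun s hs => hsub ⟨hat₀.trans_le hs.1, hs.2⟩
  -- a sup bound on `[0, t₀]` from the Tao cover at `T' = t₀`
  obtain ⟨q₀, hsol₀, hu₀, -, -⟩ := hC hν hT hsol hLH hdec ht₀
  obtain ⟨B₀, hB₀0, hB₀⟩ := exists_forall_norm_le_of_hasBoundedSobolevNormsOn hsol₀ hu₀
  obtain ⟨B₁, hB₁0, hB₁⟩ := exists_forall_norm_fderiv_le_of_hasBoundedSobolevNormsOn
    (fun t ht => (hsol₀.contDiff_velocity ht).of_le (by norm_cast)) hu₀
  obtain ⟨C₁, hC₁⟩ := hu₀ 1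
  -- the pointwise bound `‖u s x‖² ≤ M/(T−s)`, `M = B₀²T + ν`, on all of `[0, T)`
  set M : ℝ := B₀ ^ 2 * T + ν with hMdef
  have hM0 : 0 ≤ M := by positivity
  have hpt : ∀ s ∈ Ico 0 T, ∀ x, ‖u s x‖ ^ 2 ≤ M / (T - s) := by
    intro s hs x
    have hTs : 0 < T - s := sub_pos.2 hs.2
    rw [le_div_iff₀ hTs]
    by_cases hst : s < t₀
    · have h1 : ‖u s x‖ ^ 2 ≤ B₀ ^ 2 := pow_le_pow_left₀ (norm_nonneg _) (hB₀ s ⟨hs.1, hst.le⟩ x) 2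
      have h2 : T - s ≤ T := by linarith [hs.1]
      nlinarith [hν.le, sq_nonneg B₀]
    · have h1 := sq_norm_le_of_rate hν.le hs.2 (hrate' s ⟨not_lt.1 hst, hs.2⟩ x)
      rw [div_eq_mul_inv] at h1
      have h2 : ‖u s x‖ ^ 2 * (T - s) ≤ ν := by
        have := mul_le_mul_of_nonneg_right h1 hTs.le
        rwa [mul_assoc, inv_mul_cancel₀ hTs.ne', mul_one] at this
      nlinarith [sq_nonneg B₀, hT]
  -- the sup-norm bound `‖u(s)‖²_∞ ≤ B₀² + ν/(T−s)` on `[0, T)`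
  have hNsq : ∀ s ∈ Ico 0 T, (eLpNorm (u s) ⊤ volume).toReal ^ (2 : ℝ) ≤ B₀ ^ 2 + ν / (T - s) := by
    intro s hs
    have hTs : 0 < T - s := sub_pos.2 hs.2
    rw [Real.rpow_two]
    by_cases hst : s < t₀
    · have h1 : (eLpNorm (u s) ⊤ volume).toReal ≤ B₀ :=
        toReal_eLpNorm_top_le_of_bound hB₀0 (hB₀ s ⟨hs.1, hst.le⟩)
      have h2 : 0 ≤ ν / (T - s) := div_nonneg hν.le hTs.le
      nlinarith [ENNReal.toReal_nonneg (a := eLpNorm (u s) ⊤ volume)]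
    · have hb : 0 ≤ Real.sqrt (ν / (T - s)) := Real.sqrt_nonneg _
      have h1 : ∀ x, ‖u s x‖ ≤ Real.sqrt (ν / (T - s)) := fun x =>
        Real.le_sqrt_of_sq_le (sq_norm_le_of_rate hν.le hs.2 (hrate' s ⟨not_lt.1 hst, hs.2⟩ x))
      have h2 : (eLpNorm (u s) ⊤ volume).toReal ≤ Real.sqrt (ν / (T - s)) :=
        toReal_eLpNorm_top_le_of_bound hb h1
      have h3 := pow_le_pow_left₀ ENNReal.toReal_nonneg h2 2
      rw [Real.sq_sqrt (div_nonneg hν.le hTs.le)] at h3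
      nlinarith [sq_nonneg B₀]
  -- the integrated sup-norm bound `Λ(t) ≤ B₀²T + ν log(T/(T−t))`
  have hΛ : ∀ t ∈ Ioo 0 T,
      ∫⁻ s in Ioo 0 t, ENNReal.ofReal ((eLpNorm (u s) ⊤ volume).toReal ^ (2 : ℝ)) ≤
        ENNReal.ofReal (B₀ ^ 2 * T + ν * Real.log (T / (T - t))) := by
    intro t ht
    have hTt : 0 < T - t := sub_pos.2 ht.2
    have hlog : 0 ≤ Real.log (T / (T - t)) :=
      Real.log_nonneg ((one_le_div hTt).2 (by linarith [ht.1]))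
    calc ∫⁻ s in Ioo 0 t, ENNReal.ofReal ((eLpNorm (u s) ⊤ volume).toReal ^ (2 : ℝ))
        ≤ ∫⁻ s in Ioo 0 t, (ENNReal.ofReal (B₀ ^ 2) + ENNReal.ofReal (ν / (T - s))) := by
          refine setLIntegral_mono' measurableSet_Ioo fun s hs => ?_
          rw [← ENNReal.ofReal_add (sq_nonneg _) (div_nonneg hν.le (by linarith [hs.2, ht.2]))]
          exact ENNReal.ofReal_le_ofReal (hNsq s ⟨hs.1.le, hs.2.trans ht.2⟩)
      _ = ENNReal.ofReal (B₀ ^ 2) * volume (Ioo 0 t) +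
            ∫⁻ s in Ioo 0 t, ENNReal.ofReal (ν / (T - s)) := by
          rw [lintegral_add_left measurable_const, setLIntegral_const]
      _ = ENNReal.ofReal (B₀ ^ 2 * t) + ENNReal.ofReal (ν * Real.log (T / (T - t))) := by
          rw [lintegral_Ioo_div_sub_eq hν.le ht.1.le ht.2, Real.volume_Ioo, sub_zero,
            ← ENNReal.ofReal_mul (sq_nonneg _)]
      _ = ENNReal.ofReal (B₀ ^ 2 * t + ν * Real.log (T / (T - t))) :=
          (ENNReal.ofReal_add (mul_nonneg (sq_nonneg _) ht.1.le) (mul_nonneg hν.le hlog)).symm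
      _ ≤ ENNReal.ofReal (B₀ ^ 2 * T + ν * Real.log (T / (T - t))) := by
          refine ENNReal.ofReal_le_ofReal ?_
          nlinarith [sq_nonneg B₀, ht.2]
  -- finiteness at time `0`: enstrophy and weighted vorticity mass
  have h00 : (0 : ℝ) ∈ Icc 0 t₀ := ⟨le_rfl, ht₀.1.le⟩
  have hG0 : ∫⁻ x, ENNReal.ofReal (frobeniusNormSq (fderiv ℝ (u 0) x)) ≤ 3 * C₁ := by
    calc ∫⁻ x, ENNReal.ofReal (frobeniusNormSq (fderiv ℝ (u 0) x))
        ≤ ∫⁻ x, 3 * ‖iteratedFDeriv ℝ 1 (u 0) x‖ₑ ^ 2 := lintegral_mono fun x => by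
          rw [← ofReal_norm, norm_iteratedFDeriv_one, ofReal_norm]
          exact ofReal_frobeniusNormSq_le_three_mul_enorm_sq _
      _ = 3 * ∫⁻ x, ‖iteratedFDeriv ℝ 1 (u 0) x‖ₑ ^ 2 := lintegral_const_mul' _ _ (by norm_num)
      _ ≤ 3 * C₁ := by gcongr; exact hC₁ 0 h00
  have hG0top : ∫⁻ x, ENNReal.ofReal (frobeniusNormSq (fderiv ℝ (u 0) x)) ≠ ⊤ :=
    (hG0.trans_lt (ENNReal.mul_lt_top (by norm_num) ENNReal.coe_lt_top)).ne
  set Bw : ℝ := ‖(curlCLM : (EuclideanSpace ℝ (Fin 3) →L[ℝ] EuclideanSpace ℝ (Fin 3)) →L[ℝ]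
    EuclideanSpace ℝ (Fin 3))‖ * B₁ with hBw
  have hΦ0 : ∫⁻ x, ENNReal.ofReal ((‖curl (u 0) x‖ ^ 2 + 1) ^ (5 / 4 : ℝ) - 1) ≤
      ENNReal.ofReal (5 * (Bw ^ 2 + 1)) * (6 * C₁) := by
    have hwB : ∀ x, ‖curl (u 0) x‖ ≤ Bw := fun x =>
      (norm_curl_le (u 0) x).trans (mul_le_mul_of_nonneg_left (hB₁ 0 h00 x)
        (norm_nonneg (curlCLM : (EuclideanSpace ℝ (Fin 3) →L[ℝ] EuclideanSpace ℝ (Fin 3)) →L[ℝ]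
          EuclideanSpace ℝ (Fin 3))))
    calc ∫⁻ x, ENNReal.ofReal ((‖curl (u 0) x‖ ^ 2 + 1) ^ (5 / 4 : ℝ) - 1)
        ≤ ∫⁻ x, ENNReal.ofReal (5 * (Bw ^ 2 + 1)) * (6 * ‖iteratedFDeriv ℝ 1 (u 0) x‖ₑ ^ 2) := by
          refine lintegral_mono fun x => ?_
          calc ENNReal.ofReal ((‖curl (u 0) x‖ ^ 2 + 1) ^ (5 / 4 : ℝ) - 1)
              ≤ ENNReal.ofReal (5 * (Bw ^ 2 + 1) * ‖curl (u 0) x‖ ^ 2) :=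
                ENNReal.ofReal_le_ofReal (F_le_mul_sq (hwB x))
            _ = ENNReal.ofReal (5 * (Bw ^ 2 + 1)) * ‖curl (u 0) x‖ₑ ^ 2 := by
                rw [ENNReal.ofReal_mul (by positivity), ← ofReal_norm, ENNReal.ofReal_pow (norm_nonneg _)]
            _ ≤ ENNReal.ofReal (5 * (Bw ^ 2 + 1)) * (6 * ‖iteratedFDeriv ℝ 1 (u 0) x‖ₑ ^ 2) := by
                gcongr; exact enorm_curl_sq_le_six_mul (u 0) x
      _ = ENNReal.ofReal (5 * (Bw ^ 2 + 1)) * (6 * ∫⁻ x, ‖iteratedFDeriv ℝ 1 (u 0) x‖ₑ ^ 2) := by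
          rw [lintegral_const_mul' _ _ ENNReal.ofReal_ne_top, lintegral_const_mul' _ _ (by norm_num)]
      _ ≤ ENNReal.ofReal (5 * (Bw ^ 2 + 1)) * (6 * C₁) := by gcongr; exact hC₁ 0 h00
  have hΦ0top : ∫⁻ x, ENNReal.ofReal ((‖curl (u 0) x‖ ^ 2 + 1) ^ (5 / 4 : ℝ) - 1) ≠ ⊤ :=
    (hΦ0.trans_lt (ENNReal.mul_lt_top ENNReal.ofReal_lt_top
      (ENNReal.mul_lt_top (by norm_num) ENNReal.coe_lt_top))).ne
  set G0 : ℝ := (∫⁻ x, ENNReal.ofReal (frobeniusNormSq (fderiv ℝ (u 0) x))).toReal with hG0def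
  set F0 : ℝ := (∫⁻ x, ENNReal.ofReal ((‖curl (u 0) x‖ ^ 2 + 1) ^ (5 / 4 : ℝ) - 1)).toReal
    with hF0def
  have hG0nn : 0 ≤ G0 := ENNReal.toReal_nonneg
  have hF0nn : 0 ≤ F0 := ENNReal.toReal_nonneg
  -- the constants
  set K₁ : ℝ := Real.exp (15 / (16 * ν) * (B₀ ^ 2 * T)) * T ^ (15 / 16 : ℝ) * F0 with hK₁
  set K₂ : ℝ := Real.exp ((2 * ν)⁻¹ * (B₀ ^ 2 * T)) * T ^ (1 / 2 : ℝ) * G0 with hK₂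
  refine ⟨K₁, K₂, M, fun t ht => ⟨?_, ?_, hpt t ⟨ht.1.le, ht.2⟩⟩⟩
  · -- the weighted vorticity mass
    obtain ⟨q, hsolt, hut, hutt, hqt⟩ := hC hν hT hsol hLH hdec ht
    have hTt : 0 < T - t := sub_pos.2 ht.2
    have hΛt := hΛ t ht
    have hΛtop : ∫⁻ s in Ioo 0 t, ENNReal.ofReal ((eLpNorm (u s) ⊤ volume).toReal ^ (2 : ℝ)) ≠ ⊤ :=
      (hΛt.trans_lt ENNReal.ofReal_lt_top).ne
    have hmain := hA hν ht.1 hsolt hut hutt hqt ⟨ht.1, le_rfl⟩ hΛtop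
    refine hmain.trans ?_
    have hlog : 0 ≤ Real.log (T / (T - t)) :=
      Real.log_nonneg ((one_le_div hTt).2 (by linarith [ht.1]))
    have hrhs0 : 0 ≤ B₀ ^ 2 * T + ν * Real.log (T / (T - t)) := by positivity
    have hexp : Real.exp (15 / (16 * ν) *
        (∫⁻ s in Ioo 0 t, ENNReal.ofReal ((eLpNorm (u s) ⊤ volume).toReal ^ (2 : ℝ))).toReal) ≤
        Real.exp (15 / (16 * ν) * (B₀ ^ 2 * T)) * (T / (T - t)) ^ (15 / 16 : ℝ) := by
      have h1 : (∫⁻ s in Ioo 0 t, ENNReal.ofReal ((eLpNorm (u s) ⊤ volume).toReal ^ (2 : ℝ))).toReal ≤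
          B₀ ^ 2 * T + ν * Real.log (T / (T - t)) := ENNReal.toReal_le_of_le_ofReal hrhs0 hΛt
      have h2 := Real.exp_le_exp.2 (mul_le_mul_of_nonneg_left h1 (by positivity : (0:ℝ) ≤ 15 / (16 * ν)))
      refine h2.trans_eq ?_
      rw [exp_mul_add_mul_log (div_pos hT hTt)]
      congr 2
      field_simp
    have hpow : (T / (T - t)) ^ (15 / 16 : ℝ) = T ^ (15 / 16 : ℝ) * (T - t) ^ (-(15 / 16 : ℝ)) := by
      rw [Real.div_rpow hT.le hTt.le, Real.rpow_neg hTt.le, div_eq_mul_inv]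
    calc ENNReal.ofReal (Real.exp (15 / (16 * ν) *
          (∫⁻ s in Ioo 0 t, ENNReal.ofReal ((eLpNorm (u s) ⊤ volume).toReal ^ (2 : ℝ))).toReal)) *
          ∫⁻ x, ENNReal.ofReal ((‖curl (u 0) x‖ ^ 2 + 1) ^ (5 / 4 : ℝ) - 1)
        ≤ ENNReal.ofReal (Real.exp (15 / (16 * ν) * (B₀ ^ 2 * T)) * (T / (T - t)) ^ (15 / 16 : ℝ)) *
            ENNReal.ofReal F0 := by
          rw [ENNReal.ofReal_toReal hΦ0top]
          gcongr
      _ = ENNReal.ofReal (K₁ * (T - t) ^ (-(15 / 16 : ℝ))) := by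
          rw [← ENNReal.ofReal_mul (by positivity), hpow, hK₁]
          ring_nf
  · -- the enstrophy
    obtain ⟨q, hsolt, hut, hutt, hqt⟩ := hC hν hT hsol hLH hdec ht
    have hTt : 0 < T - t := sub_pos.2 ht.2
    have hΛt := hΛ t ht
    have hΛtop : ∫⁻ s in Ioo 0 t, ENNReal.ofReal ((eLpNorm (u s) ⊤ volume).toReal ^ (2 : ℝ)) ≠ ⊤ :=
      (hΛt.trans_lt ENNReal.ofReal_lt_top).ne
    have hmain := hSharp hν ht.1 hsolt hut hutt hqt ⟨ht.1, le_rfl⟩ hΛtop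
    refine hmain.trans ?_
    have hlog : 0 ≤ Real.log (T / (T - t)) :=
      Real.log_nonneg ((one_le_div hTt).2 (by linarith [ht.1]))
    have hrhs0 : 0 ≤ B₀ ^ 2 * T + ν * Real.log (T / (T - t)) := by positivity
    have hexp : Real.exp ((2 * ν)⁻¹ *
        (∫⁻ s in Ioo 0 t, ENNReal.ofReal ((eLpNorm (u s) ⊤ volume).toReal ^ (2 : ℝ))).toReal) ≤
        Real.exp ((2 * ν)⁻¹ * (B₀ ^ 2 * T)) * (T / (T - t)) ^ (1 / 2 : ℝ) := by
      have h1 : (∫⁻ s in Ioo 0 t, ENNReal.ofReal ((eLpNorm (u s) ⊤ volume).toReal ^ (2 : ℝ))).toReal ≤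
          B₀ ^ 2 * T + ν * Real.log (T / (T - t)) := ENNReal.toReal_le_of_le_ofReal hrhs0 hΛt
      have h2 := Real.exp_le_exp.2 (mul_le_mul_of_nonneg_left h1 (by positivity : (0:ℝ) ≤ (2 * ν)⁻¹))
      refine h2.trans_eq ?_
      rw [exp_mul_add_mul_log (div_pos hT hTt)]
      congr 2
      field_simp
    have hpow : (T / (T - t)) ^ (1 / 2 : ℝ) = T ^ (1 / 2 : ℝ) * (T - t) ^ (-(1 / 2 : ℝ)) := by
      rw [Real.div_rpow hT.le hTt.le, Real.rpow_neg hTt.le, div_eq_mul_inv]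
    calc ENNReal.ofReal (Real.exp ((2 * ν)⁻¹ *
          (∫⁻ s in Ioo 0 t, ENNReal.ofReal ((eLpNorm (u s) ⊤ volume).toReal ^ (2 : ℝ))).toReal)) *
          ∫⁻ x, ENNReal.ofReal (frobeniusNormSq (fderiv ℝ (u 0) x))
        ≤ ENNReal.ofReal (Real.exp ((2 * ν)⁻¹ * (B₀ ^ 2 * T)) * (T / (T - t)) ^ (1 / 2 : ℝ)) *
            ENNReal.ofReal G0 := by
          rw [ENNReal.ofReal_toReal hG0top]
          gcongr
      _ = ENNReal.ofReal (K₂ * (T - t) ^ (-(1 / 2 : ℝ))) := by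
          rw [← ENNReal.ofReal_mul (by positivity), hpow, hK₂]
          ring_nf

/-- **Stub S7a of the line `lp-vorticity-young-budget` (registered form of `aprioriDecay_of`).**
Sharp `q = 2` slab bound + weighted `L^{5/2}` slab bound (S3) + Tao cover (S5) ⇒ the a-priori
power rates `∫F(curl u(t)) ≤ K₁(T−t)^{-15/16}`, `∫|∇u(t)|² ≤ K₂(T−t)^{-1/2}`,
`‖u(t,x)‖² ≤ M/(T−t)` on `(0,T)` along rate-one solutions. -/
theorem stub_aprioriDecayOf :
    (∀ ⦃ν T : ℝ⦄, 0 < ν → 0 < T →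
      ∀ ⦃u : ℝ → EuclideanSpace ℝ (Fin 3) → EuclideanSpace ℝ (Fin 3)⦄
        ⦃p : ℝ → EuclideanSpace ℝ (Fin 3) → ℝ⦄,
        IsClassicalNSSolutionOn (Icc 0 T) ν 0 u p →
        HasBoundedSobolevNormsOn (Icc 0 T) u →
        HasBoundedSobolevNormsOn (Icc 0 T) (timeDerivWithin (Icc 0 T) u) →
        (∀ n : ℕ, ∃ C : ℝ≥0, ∀ t ∈ Icc 0 T, ∫⁻ x, ‖iteratedFDeriv ℝ n (p t) x‖ₑ ^ 2 ≤ C) →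
      ∀ ⦃s : ℝ⦄, s ∈ Ioc 0 T →
        (∫⁻ t in Ioo 0 s, ENNReal.ofReal ((eLpNorm (u t) ⊤ volume).toReal ^ (2 : ℝ)) ≠ ⊤) →
        ∫⁻ x, ENNReal.ofReal (frobeniusNormSq (fderiv ℝ (u s) x)) ≤
          ENNReal.ofReal (Real.exp ((2 * ν)⁻¹ *
              (∫⁻ t in Ioo 0 s, ENNReal.ofReal ((eLpNorm (u t) ⊤ volume).toReal ^ (2 : ℝ))).toReal)) *
            ∫⁻ x, ENNReal.ofReal (frobeniusNormSq (fderiv ℝ (u 0) x))) →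
    (∀ ⦃ν T : ℝ⦄, 0 < ν → 0 < T →
      ∀ ⦃u : ℝ → EuclideanSpace ℝ (Fin 3) → EuclideanSpace ℝ (Fin 3)⦄
        ⦃p : ℝ → EuclideanSpace ℝ (Fin 3) → ℝ⦄,
        IsClassicalNSSolutionOn (Icc 0 T) ν 0 u p →
        HasBoundedSobolevNormsOn (Icc 0 T) u →
        HasBoundedSobolevNormsOn (Icc 0 T) (timeDerivWithin (Icc 0 T) u) →
        (∀ n : ℕ, ∃ C : ℝ≥0, ∀ t ∈ Icc 0 T, ∫⁻ x, ‖iteratedFDeriv ℝ n (p t) x‖ₑ ^ 2 ≤ C) →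
      ∀ ⦃s : ℝ⦄, s ∈ Ioc 0 T →
        (∫⁻ t in Ioo 0 s, ENNReal.ofReal ((eLpNorm (u t) ⊤ volume).toReal ^ (2 : ℝ)) ≠ ⊤) →
        ∫⁻ x, ENNReal.ofReal ((‖curl (u s) x‖ ^ 2 + 1) ^ (5 / 4 : ℝ) - 1) ≤
          ENNReal.ofReal (Real.exp (15 / (16 * ν) *
              (∫⁻ t in Ioo 0 s, ENNReal.ofReal ((eLpNorm (u t) ⊤ volume).toReal ^ (2 : ℝ))).toReal)) *
            ∫⁻ x, ENNReal.ofReal ((‖curl (u 0) x‖ ^ 2 + 1) ^ (5 / 4 : ℝ) - 1)) →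
    (∀ ⦃ν T : ℝ⦄, 0 < ν → 0 < T →
      ∀ ⦃u : ℝ → EuclideanSpace ℝ (Fin 3) → EuclideanSpace ℝ (Fin 3)⦄
        ⦃p : ℝ → EuclideanSpace ℝ (Fin 3) → ℝ⦄,
        IsClassicalNSSolutionOn (Ico 0 T) ν 0 u p → IsLerayHopfOn T ν 0 (u 0) u →
        HasRapidSpatialDecay (u 0) →
      ∀ ⦃T' : ℝ⦄, T' ∈ Ioo 0 T →
        ∃ q : ℝ → EuclideanSpace ℝ (Fin 3) → ℝ,
          IsClassicalNSSolutionOn (Icc 0 T') ν 0 u q ∧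
          HasBoundedSobolevNormsOn (Icc 0 T') u ∧
          HasBoundedSobolevNormsOn (Icc 0 T') (timeDerivWithin (Icc 0 T') u) ∧
          (∀ n : ℕ, ∃ C : ℝ≥0, ∀ t ∈ Icc 0 T', ∫⁻ x, ‖iteratedFDeriv ℝ n (q t) x‖ₑ ^ 2 ≤ C)) →
    ∀ ⦃ν T : ℝ⦄, 0 < ν → 0 < T →
    ∀ ⦃u : ℝ → EuclideanSpace ℝ (Fin 3) → EuclideanSpace ℝ (Fin 3)⦄
      ⦃p : ℝ → EuclideanSpace ℝ (Fin 3) → ℝ⦄,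
      IsClassicalNSSolutionOn (Ico 0 T) ν 0 u p → IsLerayHopfOn T ν 0 (u 0) u →
      HasRapidSpatialDecay (u 0) →
      (∀ᶠ t in 𝓝[<] T, ∀ x, Real.sqrt (T - t) * ‖u t x‖ ≤ Real.sqrt ν) →
      ∃ K₁ K₂ M : ℝ, ∀ t ∈ Ioo 0 T,
        (∫⁻ x, ENNReal.ofReal ((‖curl (u t) x‖ ^ 2 + 1) ^ (5 / 4 : ℝ) - 1) ≤
          ENNReal.ofReal (K₁ * (T - t) ^ (-(15 / 16 : ℝ)))) ∧
        (∫⁻ x, ENNReal.ofReal (frobeniusNormSq (fderiv ℝ (u t) x)) ≤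
          ENNReal.ofReal (K₂ * (T - t) ^ (-(1 / 2 : ℝ)))) ∧
        (∀ x, ‖u t x‖ ^ 2 ≤ M / (T - t)) :=
  fun h₁ h₂ h₃ _ν _T hν hT _u _p hsol hLH hdec hrate => aprioriDecay_of h₁ h₂ h₃ hν hT hsol hLH hdec hrate

end Summit.NavierStokesRegularity.NavierStokesRegularity.Theorems.RungReynoldsOne

end
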